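import Summits.QuantumFields.YangMills.Theorems.FluctuationComparisonRegPrIntLOrganTangentSigmaChartJunction
import Summits.QuantumFields.YangMills.Theorems.FluctuationComparisonRegPrIntLOrganTangentFibreMeanTransport
import Summits.QuantumFields.YangMills.Theorems.FluctuationComparisonRegPrIntLOrganTangentMultiWindowWeight
import Literature.MathematicalPhysics.QuantumFieldTheory.Balaban1983to89.T3TowerWeightDensity
import HarnessLib

/-!
# Crux `FluctuationComparisonRegPrIntL` (stmt-QuantumFields-20520, rung R3), PATH-B organ — LIN knit step 2 ASSEMBLED (LEAD w3 g25):
# the σ-VERSION `mfun` of LINᵘ-H IS the CHART RATIO `(∫ (χ·h·ρ′)(Φ(V,z))·J dτ) ∕ (∫ (χ·ρ′)(Φ(V,z))·J dτ)` at EVERY window point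

Cell `ym3-torus` (YM ladder rung R3 = continuum `SU(2)` Yang–Mills on the three-torus — a RUNG: NOT d = 4, NOT infinite volume, NOT a mass gap, NOT Clay).
LEAD-20520 width seat `ym-ust-20520-w3` (gen 25), helper on crux 20520 (`--supports`, count-neutral, DEF-FREE, default heartbeats).
Over ✓`…OrganTangentSigmaChartJunction.ae_integral_sigma_eq_chart` (twice: numerator and mass — the base density `r = T_{j,Ts}(1)` of
✓`map_descendTo_withDensity` CANCELS in the ratio, no positivity of `r` needed), the chart-mass positivity (SpreadFibreLawH [9]), dominated
continuity of the chart integrals ([7], [8]) and ✓`eq_on_window_of_ae`.  This is the `hrep` step of the LEAD's LIN knit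
(`Cruxes/…/LinKnit_LEAD_w3g25.lean`): with `wgt₀ = (χ·ρ′)(Φ)·J ∕ ∫(χ·ρ′)(Φ)·J` the right side is `∫ h(Φ(V,z))·wgt₀(V,z) dτ`.

HONEST FRAMING: measure-theoretic plumbing over HYPOTHESIS data (σ-binders, σ-version, chart letters); nothing of Bałaban's analysis is asserted
or proved; `SpreadFibreLawH` ∕ LINᵘ-H″ ∕ O1ᵘ-H ∕ S1aᴴ ∕ S2α′ ∕ S2β ∕ 26243 OPEN; crux 20520 `FluctuationComparisonRegPrIntL` ∕ `YM3TorusSU2` NOT proved; registry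
untouched; rung R3 = SU(2) YM₃ on T³ at fixed lattice data — NOT d = 4, NOT infinite volume, NOT a mass gap, NOT Clay; the Yang–Mills mass gap is NOT proved.
-/

set_option autoImplicit false

noncomputable section

namespace Summit.QuantumFields.YangMills.Theorems.OrganTangentSigmaVersionChartMean

open MeasureTheory ProbabilityTheory Filter Topology
open scoped ENNReal NNReal
open Literature.MathematicalPhysics.QuantumFieldTheory.Balaban1983to89 T3ContinuumYM3Torus T3NestedUnitLaws
  T3UnitLawDensityEML T4Continuum T3UnitScaleTilt T3LevelShift T3TiltDescent
open Literature.MathematicalPhysics.QuantumFieldTheory.Balaban1983to89.T3TowerWeightDensity (towerWeightDensity towerWeightDensity_nonneg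
  measurable_towerWeightDensity map_descendTo_withDensity)
open Summit.QuantumFields.YangMills.Theorems.OrganTangentSigmaChartJunction (ae_integral_sigma_eq_chart)
open Summit.QuantumFields.YangMills.BalabanUVNodes.N09DomAltThresholdNull (isOpen_setOf_plaqSmall_SU)
open Literature.MathematicalPhysics.QuantumFieldTheory.Balaban1983to89.B12ContinuousTransportInvarianceOn (continuous_dist1_SU continuous_plaqHol_SU)
open Summit.QuantumFields.YangMills.Theorems.OrganTangentFibreMeanTransport (eq_on_window_of_ae)

/-! ## §1 Two topological helpers -/

/-- PASTING: `χ·g` is continuous when `χ` is continuous and supported in a closed `C ⊆ O`, `O` open, `g` continuous on `O`. [folklore] -/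
theorem continuous_mul_of_support {α : Type*} [TopologicalSpace α] {χ g : α → ℝ} {O C : Set α} (hO : IsOpen O) (hC : IsClosed C)
    (hCO : C ⊆ O) (hχ : Continuous χ) (hsupp : ∀ x, χ x ≠ 0 → x ∈ C) (hg : ContinuousOn g O) :
    Continuous fun x => χ x * g x := by
  refine continuous_iff_continuousAt.2 fun x => ?_
  by_cases hx : x ∈ O
  · exact hχ.continuousAt.mul (hg.continuousAt (hO.mem_nhds hx))
  · have hxC : x ∉ C := fun h => hx (hCO h)
    have hev : (fun x => χ x * g x) =ᶠ[𝓝 x] fun _ => 0 := by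
      filter_upwards [hC.isOpen_compl.mem_nhds hxC] with y hy
      have : χ y = 0 := by
        by_contra h
        exact hy (hsupp y h)
      rw [this, zero_mul]
    exact (continuousAt_const.congr hev.symm)

/-- A continuous real function on a compact space is bounded in absolute value. [folklore] -/
theorem exists_abs_le_of_continuous {α : Type*} [TopologicalSpace α] [CompactSpace α] {f : α → ℝ} (hf : Continuous f) :
    ∃ M : ℝ, ∀ x, |f x| ≤ M := by
  obtain ⟨M, hM⟩ := isCompact_univ.exists_bound_of_continuousOn hf.continuousOn
  exact ⟨M, fun x => by rw [← Real.norm_eq_abs]; exact hM x (Set.mem_univ x)⟩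

/-! ## §2 The σ-version of the fibre mean IS the chart ratio, at every window point -/

variable (F : T3Family)

/-- ★★★ **σ-VERSION = CHART RATIO ON THE WINDOW.**  Frame `(j, Ts)`, `j + 1 ≤ Ts`, level-`Ts` densities `ρ ρ′` (measurable, continuous and positive on the
`θ_Ts`-window), the multi-window cut `χ` (continuous, `≥ 0`, supported in `MW` and positive there — ✓`exists_height_multiWindowWeight`), LINᵘ-H's σ-binders
(Markov `σ`, bind identity, fibre support) and σ-VERSION `mfun` (window-continuous, a.e. equal to the σ-fibre-mean ratio), and SpreadFibreLawH v0.3's CHART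
conjuncts [1]–[9] (`Φ J S τ`: measurable, `MW ⊆ S`, section, disintegration on `S`, window-continuity, `J ≤ CJ`, positive mass).  THEN at EVERY window point
`V`: the chart mass `∫ (χ·ρ′)(Φ(V,z))·J(V,z) dτ` is positive and `mfun V = (∫ (χ·h·ρ′)(Φ(V,z))·J dτ) ∕ (∫ (χ·ρ′)(Φ(V,z))·J dτ)`, `h = log ρ − log ρ′`.
Mechanism: ✓`map_descendTo_withDensity` (the base density `r = T(1)`), ✓`ae_integral_sigma_eq_chart` twice (`r` cancels in the ratio), positivity of the mass,
dominated continuity of the chart integrals ([7][8]), ✓`eq_on_window_of_ae`. [cite: Balaban1985Averaging, (10)-(13) p.19] [cite: Balaban1987RG1, p.259] (bookkeeping; [folklore]) -/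
theorem sigmaVersion_eq_chartRatio (γ b₀ p₀ : ℝ) (j Ts : ℕ) (hjTs : j + 1 ≤ Ts)
    (ρ ρ' : GaugeField (F.P Ts) 0 ↥(Matrix.specialUnitaryGroup (Fin 2) ℂ) → ℝ)
    (hρm : Measurable ρ) (hρ'm : Measurable ρ')
    (hρc : ContinuousOn ρ {U | PlaqSmall (θBal F.L γ b₀ p₀ Ts) U}) (hρ'c : ContinuousOn ρ' {U | PlaqSmall (θBal F.L γ b₀ p₀ Ts) U})
    (hρpos : ∀ U, PlaqSmall (θBal F.L γ b₀ p₀ Ts) U → 0 < ρ U ∧ 0 < ρ' U)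
    (hθ : 0 < θBal F.L γ b₀ p₀ Ts)
    -- the cut
    (χ : GaugeField (F.P Ts) 0 ↥(Matrix.specialUnitaryGroup (Fin 2) ℂ) → ℝ) (hχc : Continuous χ) (hχm : Measurable χ) (hχ0 : ∀ U, 0 ≤ χ U)
    (hχsupp : ∀ U, χ U ≠ 0 → ∀ (n : ℕ) (hjn : j + 1 ≤ n) (hnK : n ≤ Ts), PlaqSmall (24 / 25 * θBal F.L γ b₀ p₀ n) (descendTo F ℰp n Ts hnK U))
    (hχpos : ∀ U, (∀ (n : ℕ) (hjn : j + 1 ≤ n) (hnK : n ≤ Ts), PlaqSmall (24 / 25 * θBal F.L γ b₀ p₀ n) (descendTo F ℰp n Ts hnK U)) → 0 < χ U)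
    -- LIN's σ-binders and σ-version
    (σ : Kernel (GaugeField (F.P j) 0 ↥(Matrix.specialUnitaryGroup (Fin 2) ℂ)) (GaugeField (F.P Ts) 0 ↥(Matrix.specialUnitaryGroup (Fin 2) ℂ)))
    [IsMarkovKernel σ]
    (hσb : (Measure.map (descendTo F ℰp j Ts (Nat.le_of_succ_le hjTs)) (fieldMeasure (F.P Ts) 0 ↥(Matrix.specialUnitaryGroup (Fin 2) ℂ))).bind ⇑σ
      = fieldMeasure (F.P Ts) 0 ↥(Matrix.specialUnitaryGroup (Fin 2) ℂ))
    (hσf : ∀ᵐ V ∂(Measure.map (descendTo F ℰp j Ts (Nat.le_of_succ_le hjTs)) (fieldMeasure (F.P Ts) 0 ↥(Matrix.specialUnitaryGroup (Fin 2) ℂ))),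
      ∀ᵐ U ∂(σ V), descendTo F ℰp j Ts (Nat.le_of_succ_le hjTs) U = V)
    (mfun : GaugeField (F.P j) 0 ↥(Matrix.specialUnitaryGroup (Fin 2) ℂ) → ℝ)
    (hmc : ContinuousOn mfun {V | PlaqSmall (θBal F.L γ b₀ p₀ j) V})
    (hmae : ∀ᵐ V ∂(fieldMeasure (F.P j) 0 ↥(Matrix.specialUnitaryGroup (Fin 2) ℂ)), PlaqSmall (θBal F.L γ b₀ p₀ j) V →
      mfun V = (∫ U, χ U * (Real.log (ρ U) - Real.log (ρ' U)) * ρ' U ∂(σ V)) / (∫ U, χ U * ρ' U ∂(σ V)))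
    -- the chart
    {Z : Type*} [MeasurableSpace Z] (τ : Measure Z) [IsProbabilityMeasure τ]
    (Φ : GaugeField (F.P j) 0 ↥(Matrix.specialUnitaryGroup (Fin 2) ℂ) × Z → GaugeField (F.P Ts) 0 ↥(Matrix.specialUnitaryGroup (Fin 2) ℂ))
    (J : GaugeField (F.P j) 0 ↥(Matrix.specialUnitaryGroup (Fin 2) ℂ) × Z → ℝ≥0)
    (S : Set (GaugeField (F.P Ts) 0 ↥(Matrix.specialUnitaryGroup (Fin 2) ℂ)))
    (hΦm : Measurable Φ) (hJm : Measurable J) (hSm : MeasurableSet S)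
    (hS : ∀ U, (∀ (n : ℕ) (hjn : j + 1 ≤ n) (hnK : n ≤ Ts), PlaqSmall (24 / 25 * θBal F.L γ b₀ p₀ n) (descendTo F ℰp n Ts hnK U)) → U ∈ S)
    (hdis : ∀ A : Set (GaugeField (F.P j) 0 ↥(Matrix.specialUnitaryGroup (Fin 2) ℂ)), MeasurableSet A →
      (fieldMeasure (F.P Ts) 0 ↥(Matrix.specialUnitaryGroup (Fin 2) ℂ)).restrict (descendTo F ℰp j Ts (Nat.le_of_succ_le hjTs) ⁻¹' A ∩ S)
        = ((((fieldMeasure (F.P j) 0 ↥(Matrix.specialUnitaryGroup (Fin 2) ℂ)).restrict A).prod τ).withDensity (fun p => (J p : ℝ≥0∞))).map Φ)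
    (hcont : ∀ f : GaugeField (F.P Ts) 0 ↥(Matrix.specialUnitaryGroup (Fin 2) ℂ) → ℝ, Continuous f →
      (∀ U, f U ≠ 0 → (∀ (n : ℕ) (hjn : j + 1 ≤ n) (hnK : n ≤ Ts), PlaqSmall (24 / 25 * θBal F.L γ b₀ p₀ n) (descendTo F ℰp n Ts hnK U))) →
      ∀ z, ContinuousOn (fun V => (J (V, z) : ℝ) * f (Φ (V, z))) {V | PlaqSmall (θBal F.L γ b₀ p₀ j) V})
    (CJ : ℝ) (hJle : ∀ V z, (J (V, z) : ℝ) ≤ CJ)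
    (hpos : ∀ V, PlaqSmall (θBal F.L γ b₀ p₀ j) V →
      0 < ∫⁻ z in {z | (∀ (n : ℕ) (hjn : j + 1 ≤ n) (hnK : n ≤ Ts), PlaqSmall (24 / 25 * θBal F.L γ b₀ p₀ n) (descendTo F ℰp n Ts hnK (Φ (V, z))))},
        (J (V, z) : ℝ≥0∞) ∂τ) :
    ∀ V, PlaqSmall (θBal F.L γ b₀ p₀ j) V →
      0 < ∫ z, (χ (Φ (V, z)) * ρ' (Φ (V, z))) * (J (V, z) : ℝ) ∂τ ∧
      mfun V = (∫ z, (χ (Φ (V, z)) * (Real.log (ρ (Φ (V, z))) - Real.log (ρ' (Φ (V, z)))) * ρ' (Φ (V, z))) * (J (V, z) : ℝ) ∂τ)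
        / (∫ z, (χ (Φ (V, z)) * ρ' (Φ (V, z))) * (J (V, z) : ℝ) ∂τ) := by
  classical
  haveI : CompactSpace (GaugeField (F.P Ts) 0 ↥(Matrix.specialUnitaryGroup (Fin 2) ℂ)) :=
    inferInstanceAs (CompactSpace (PBond (F.P Ts) 0 → ↥(Matrix.specialUnitaryGroup (Fin 2) ℂ)))
  -- abbreviations
  set d := descendTo F ℰp j Ts (Nat.le_of_succ_le hjTs) with hd_def
  have hd : Measurable d := measurable_descendTo F ℰp measurableE_ℰp _
  set μT := fieldMeasure (F.P Ts) 0 ↥(Matrix.specialUnitaryGroup (Fin 2) ℂ) with hμT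
  set μj := fieldMeasure (F.P j) 0 ↥(Matrix.specialUnitaryGroup (Fin 2) ℂ) with hμj
  set MW : GaugeField (F.P Ts) 0 ↥(Matrix.specialUnitaryGroup (Fin 2) ℂ) → Prop := fun U =>
    ∀ (n : ℕ) (hjn : j + 1 ≤ n) (hnK : n ≤ Ts), PlaqSmall (24 / 25 * θBal F.L γ b₀ p₀ n) (descendTo F ℰp n Ts hnK U) with hMW
  set h : GaugeField (F.P Ts) 0 ↥(Matrix.specialUnitaryGroup (Fin 2) ℂ) → ℝ := fun U => Real.log (ρ U) - Real.log (ρ' U) with hh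
  set f₁ : GaugeField (F.P Ts) 0 ↥(Matrix.specialUnitaryGroup (Fin 2) ℂ) → ℝ := fun U => χ U * h U * ρ' U with hf₁
  set f₂ : GaugeField (F.P Ts) 0 ↥(Matrix.specialUnitaryGroup (Fin 2) ℂ) → ℝ := fun U => χ U * ρ' U with hf₂
  -- the top-level window contains `MW`, and `MW` lies in the closed `24∕25`-window
  have hθ' : 0 < 24 / 25 * θBal F.L γ b₀ p₀ Ts := by positivity
  have hMWtop : ∀ U, MW U → PlaqSmall (24 / 25 * θBal F.L γ b₀ p₀ Ts) U := by
    intro U hU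
    have := hU Ts hjTs le_rfl
    rwa [T3DescentFibreTower.descendTo_self] at this
  set C : Set (GaugeField (F.P Ts) 0 ↥(Matrix.specialUnitaryGroup (Fin 2) ℂ)) :=
    {U | ∀ p, dist1 (GaugeField.plaqHol U p) ≤ 24 / 25 * θBal F.L γ b₀ p₀ Ts} with hC
  have hCclosed : IsClosed C := by
    have : C = ⋂ p, {U | dist1 (GaugeField.plaqHol U p) ≤ 24 / 25 * θBal F.L γ b₀ p₀ Ts} := by
      ext U; simp only [hC, Set.mem_setOf_eq, Set.mem_iInter]
    rw [this]
    exact isClosed_iInter fun p => isClosed_le ((continuous_dist1_SU (N := 2)).comp (continuous_plaqHol_SU (N := 2) p)) continuous_const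
  have hO : IsOpen {U : GaugeField (F.P Ts) 0 ↥(Matrix.specialUnitaryGroup (Fin 2) ℂ) | PlaqSmall (θBal F.L γ b₀ p₀ Ts) U} :=
    isOpen_setOf_plaqSmall_SU 2 _ _ _
  have hCO : C ⊆ {U | PlaqSmall (θBal F.L γ b₀ p₀ Ts) U} := by
    intro U hU p
    exact lt_of_le_of_lt (hU p) (by linarith)
  have hχC : ∀ U, χ U ≠ 0 → U ∈ C := fun U hU p => le_of_lt (hMWtop U (hχsupp U hU) p)
  -- continuity, measurability, boundedness of `f₁ f₂`
  have hhc : ContinuousOn h {U | PlaqSmall (θBal F.L γ b₀ p₀ Ts) U} := by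
    refine ContinuousOn.sub (hρc.log fun U hU => (hρpos U hU).1.ne') (hρ'c.log fun U hU => (hρpos U hU).2.ne')
  have hχhc : Continuous fun U => χ U * h U := continuous_mul_of_support hO hCclosed hCO hχc hχC hhc
  have hχhC : ∀ U, χ U * h U ≠ 0 → U ∈ C := fun U hU => hχC U (left_ne_zero_of_mul hU)
  have hf₁c : Continuous f₁ := continuous_mul_of_support hO hCclosed hCO hχhc hχhC hρ'c
  have hf₂c : Continuous f₂ := continuous_mul_of_support hO hCclosed hCO hχc hχC hρ'c
  have hhm : Measurable h := (Real.measurable_log.comp hρm).sub (Real.measurable_log.comp hρ'm)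
  have hf₁m : Measurable f₁ := (hχm.mul hhm).mul hρ'm
  have hf₂m : Measurable f₂ := hχm.mul hρ'm
  obtain ⟨M₁, hM₁⟩ := exists_abs_le_of_continuous hf₁c
  obtain ⟨M₂, hM₂⟩ := exists_abs_le_of_continuous hf₂c
  have hf₁S : ∀ U, U ∉ S → f₁ U = 0 := by
    intro U hU
    have : χ U = 0 := by
      by_contra hne
      exact hU (hS U (hχsupp U hne))
    simp only [hf₁, this, zero_mul]
  have hf₂S : ∀ U, U ∉ S → f₂ U = 0 := by
    intro U hU
    have : χ U = 0 := by
      by_contra hne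
      exact hU (hS U (hχsupp U hne))
    simp only [hf₂, this, zero_mul]
  have hf₁supp : ∀ U, f₁ U ≠ 0 → MW U := fun U hU => hχsupp U (left_ne_zero_of_mul (left_ne_zero_of_mul hU))
  have hf₂supp : ∀ U, f₂ U ≠ 0 → MW U := fun U hU => hχsupp U (left_ne_zero_of_mul hU)
  -- the base density `r := T(1)` of `μT.map d` w.r.t. `μj`
  have hone : Integrable (fun _ : GaugeField (F.P Ts) 0 ↥(Matrix.specialUnitaryGroup (Fin 2) ℂ) => (1 : ℝ)) μT := integrable_const _
  have hmap0 := map_descendTo_withDensity F (Nat.le_of_succ_le hjTs) (g := fun _ => (1 : ℝ)) (fun _ => zero_le_one) measurable_const hone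
  set r : GaugeField (F.P j) 0 ↥(Matrix.specialUnitaryGroup (Fin 2) ℂ) → ℝ≥0 := fun V =>
    Real.toNNReal (towerWeightDensity F (Nat.le_of_succ_le hjTs) (fun _ => (1 : ℝ)) V) with hr
  have hTnn : ∀ V, 0 ≤ towerWeightDensity F (Nat.le_of_succ_le hjTs) (fun _ => (1 : ℝ)) V := fun V =>
    towerWeightDensity_nonneg F (Nat.le_of_succ_le hjTs) (g := fun _ => (1 : ℝ)) (fun _ => zero_le_one) V
  have hrm : Measurable r :=
    (measurable_towerWeightDensity F (Nat.le_of_succ_le hjTs) (g := fun _ => (1 : ℝ)) (fun _ => zero_le_one) measurable_const).real_toNNReal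
  have hrcoe : ∀ V, (r V : ℝ) = towerWeightDensity F (Nat.le_of_succ_le hjTs) (fun _ => (1 : ℝ)) V := fun V =>
    Real.coe_toNNReal _ (hTnn V)
  have hmap : μT.map d = μj.withDensity (fun V => (r V : ℝ≥0∞)) := by
    have e1 : μT.withDensity (fun _ => ENNReal.ofReal (1 : ℝ)) = μT := by
      rw [ENNReal.ofReal_one]; exact withDensity_one
    have h2 := hmap0
    rw [e1] at h2
    exact h2
  haveI : SFinite τ := inferInstance
  -- (3) the two a.e. identities (numerator, mass): `r V·∫ fᵢ ∂σV = ∫ fᵢ(Φ(V,z))·J ∂τ`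
  have e1 := ae_integral_sigma_eq_chart μT μj τ hd σ hσb hσf hrm hmap hΦm hJm hSm hdis hf₁m hf₁S hM₁
  have e2 := ae_integral_sigma_eq_chart μT μj τ hd σ hσb hσf hrm hmap hΦm hJm hSm hdis hf₂m hf₂S hM₂
  -- (4) sign and positivity of the mass integrand
  have hf₂nn : ∀ U, 0 ≤ f₂ U := by
    intro U
    by_cases hU : χ U = 0
    · simp only [hf₂, hU, zero_mul, le_refl]
    · exact mul_nonneg (hχ0 U) (hρpos U (hCO (hχC U hU))).2.le
  have hf₂pos : ∀ U, MW U → 0 < f₂ U := fun U hU =>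
    mul_pos (hχpos U hU) (hρpos U (hCO (fun p => le_of_lt (hMWtop U hU p)))).2
  have hJm1 : ∀ V, Measurable fun z => (J (V, z) : ℝ) := fun V => (hJm.comp (measurable_const.prodMk measurable_id)).coe_nnreal_real
  have hΦm1 : ∀ V, Measurable fun z => Φ (V, z) := fun V => hΦm.comp (measurable_const.prodMk measurable_id)
  have hint : ∀ (f : GaugeField (F.P Ts) 0 ↥(Matrix.specialUnitaryGroup (Fin 2) ℂ) → ℝ) (M : ℝ), Measurable f → (∀ U, |f U| ≤ M) →
      ∀ V, Integrable (fun z => f (Φ (V, z)) * (J (V, z) : ℝ)) τ := by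
    intro f M hfm hfM V
    refine Integrable.mono' (integrable_const (M * CJ)) ((hfm.comp (hΦm1 V)).mul (hJm1 V)).aestronglyMeasurable
      (Eventually.of_forall fun z => ?_)
    rw [Real.norm_eq_abs, abs_mul, abs_of_nonneg (NNReal.coe_nonneg _)]
    have hM0 : 0 ≤ M := (abs_nonneg _).trans (hfM (Φ (V, z)))
    exact mul_le_mul (hfM _) (hJle V z) (NNReal.coe_nonneg _) hM0
  have hMpos : ∀ V, PlaqSmall (θBal F.L γ b₀ p₀ j) V → 0 < ∫ z, f₂ (Φ (V, z)) * (J (V, z) : ℝ) ∂τ := by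
    intro V hV
    have hnn : 0 ≤ fun z => f₂ (Φ (V, z)) * (J (V, z) : ℝ) := fun z => mul_nonneg (hf₂nn _) (NNReal.coe_nonneg _)
    rw [integral_pos_iff_support_of_nonneg hnn (hint f₂ M₂ hf₂m hM₂ V)]
    -- the multi-window set through the chart is measurable
    have hMWm : MeasurableSet {z | MW (Φ (V, z))} := by
      have : {z | MW (Φ (V, z))} = ⋂ (n : ℕ), ⋂ (hjn : j + 1 ≤ n), ⋂ (hnK : n ≤ Ts),
          (fun z => descendTo F ℰp n Ts hnK (Φ (V, z))) ⁻¹' {W | PlaqSmall (24 / 25 * θBal F.L γ b₀ p₀ n) W} := by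
        ext z; simp only [hMW, Set.mem_setOf_eq, Set.mem_iInter, Set.mem_preimage]
      rw [this]
      exact MeasurableSet.iInter fun n => MeasurableSet.iInter fun hjn => MeasurableSet.iInter fun hnK =>
        ((measurable_descendTo F ℰp measurableE_ℰp hnK).comp (hΦm1 V)) (measurableSet_plaqSmall _)
    by_contra hle
    have hzero : τ (Function.support fun z => f₂ (Φ (V, z)) * (J (V, z) : ℝ)) = 0 := le_antisymm (not_lt.1 hle) bot_le
    -- then `J(V,·) = 0` a.e. on the multi-window set, contradicting the positive chart mass [9]
    have hae0 : ∀ᵐ z ∂τ, f₂ (Φ (V, z)) * (J (V, z) : ℝ) = 0 := ae_iff.2 hzero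
    have hJ0 : ∀ᵐ z ∂(τ.restrict {z | MW (Φ (V, z))}), (J (V, z) : ℝ≥0∞) = 0 := by
      rw [ae_restrict_iff' hMWm]
      filter_upwards [hae0] with z hz hzMW
      have hf : f₂ (Φ (V, z)) ≠ 0 := (hf₂pos _ hzMW).ne'
      have hJr : (J (V, z) : ℝ) = 0 := by
        rcases mul_eq_zero.1 hz with h | h
        · exact absurd h hf
        · exact h
      have : J (V, z) = 0 := by exact_mod_cast hJr
      rw [this]; rfl
    have h0 : ∫⁻ z in {z | MW (Φ (V, z))}, (J (V, z) : ℝ≥0∞) ∂τ = 0 :=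
      (lintegral_congr_ae hJ0).trans lintegral_zero
    exact (lt_irrefl (0 : ℝ≥0∞)) (h0 ▸ hpos V hV)
  -- (5) a.e. on the window: `mfun = N∕M`
  have hae : ∀ᵐ V ∂μj, PlaqSmall (θBal F.L γ b₀ p₀ j) V →
      mfun V = (∫ z, f₁ (Φ (V, z)) * (J (V, z) : ℝ) ∂τ) / (∫ z, f₂ (Φ (V, z)) * (J (V, z) : ℝ) ∂τ) := by
    filter_upwards [hmae, e1, e2] with V hm h1 h2 hV
    rw [hm hV]
    obtain ⟨-, h1⟩ := h1
    obtain ⟨-, h2⟩ := h2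
    have hM := hMpos V hV
    have hr0 : (r V : ℝ) ≠ 0 := by
      intro h0
      rw [h0, zero_mul] at h2
      exact hM.ne h2
    have e : (∫ U, f₁ U ∂(σ V)) / (∫ U, f₂ U ∂(σ V)) = ((r V : ℝ) * ∫ U, f₁ U ∂(σ V)) / ((r V : ℝ) * ∫ U, f₂ U ∂(σ V)) :=
      (mul_div_mul_left _ _ hr0).symm
    show (∫ U, χ U * (Real.log (ρ U) - Real.log (ρ' U)) * ρ' U ∂(σ V)) / (∫ U, χ U * ρ' U ∂(σ V)) = _
    exact e.trans (by rw [h1, h2])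
  -- (6) window-continuity of numerator and mass (dominated convergence over [7], [8])
  have hcontN : ∀ (f : GaugeField (F.P Ts) 0 ↥(Matrix.specialUnitaryGroup (Fin 2) ℂ) → ℝ) (M : ℝ), Continuous f → Measurable f →
      (∀ U, |f U| ≤ M) → (∀ U, f U ≠ 0 → MW U) →
      ContinuousOn (fun V => ∫ z, f (Φ (V, z)) * (J (V, z) : ℝ) ∂τ) {V | PlaqSmall (θBal F.L γ b₀ p₀ j) V} := by
    intro f M hfc hfm hfM hfsupp
    haveI : FirstCountableTopology (GaugeField (F.P j) 0 ↥(Matrix.specialUnitaryGroup (Fin 2) ℂ)) :=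
      inferInstanceAs (FirstCountableTopology (PBond (F.P j) 0 → ↥(Matrix.specialUnitaryGroup (Fin 2) ℂ)))
    refine continuousOn_of_dominated (bound := fun _ => M * CJ) (fun V _ => ((hfm.comp (hΦm1 V)).mul (hJm1 V)).aestronglyMeasurable)
      (fun V _ => Eventually.of_forall fun z => ?_) (integrable_const _) (Eventually.of_forall fun z => ?_)
    · rw [Real.norm_eq_abs, abs_mul, abs_of_nonneg (NNReal.coe_nonneg _)]
      have hM0 : 0 ≤ M := (abs_nonneg _).trans (hfM (Φ (V, z)))
      exact mul_le_mul (hfM _) (hJle V z) (NNReal.coe_nonneg _) hM0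
    · exact (hcont f hfc hfsupp z).congr fun V _ => mul_comm _ _
  have hNc := hcontN f₁ M₁ hf₁c hf₁m hM₁ hf₁supp
  have hMc := hcontN f₂ M₂ hf₂c hf₂m hM₂ hf₂supp
  have hRc : ContinuousOn (fun V => (∫ z, f₁ (Φ (V, z)) * (J (V, z) : ℝ) ∂τ) / (∫ z, f₂ (Φ (V, z)) * (J (V, z) : ℝ) ∂τ))
      {V | PlaqSmall (θBal F.L γ b₀ p₀ j) V} := hNc.div hMc fun V hV => (hMpos V hV).ne'
  -- (7) upgrade to every window point
  have hall := eq_on_window_of_ae (F.P j) 0 (θBal F.L γ b₀ p₀ j) hmc hRc hae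
  intro V hV
  exact ⟨hMpos V hV, hall V hV⟩

end Summit.QuantumFields.YangMills.Theorems.OrganTangentSigmaVersionChartMean
end
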